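import Summits.AtomisticToContinuum.Crystallization.Theorems.FrustratedLawDichotomyAveragingRule

/-!
# FrustratedLawDichotomy · the UNCAPPED crystallinity flag is NOT a local feature (and lens-5's uncapped averaging rule is not `IsLocal`)

The honest caveat of `…AveragingRule` / `…AveragingRuleCap` (hand-2 g13) as a THEOREM.  The door's two-shell fit predicate `GoodAt η`
(`…RangeCut`) is SCALE-FREE: its fit scale `d` is the site's own nearest-neighbour distance, unbounded above, and the predicate reads every atom
out to `13/10·d`.  Witness: the perfect fcc kissing dozen at scale `s` around an atom at the origin (`fccStar s`, 13 atoms).  Its centre is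
`η`-good for every `η > 0` (`goodAt_fccStar_centre`), while the one-atom sub-cluster `{centre}` — which contains EVERY atom within `ρ < s` of the
centre — is not (`not_goodAt_of_subsingleton_range`).  Hence

* `not_isLocalFeature_goodAt` — for every radius `ρ` and every `η > 0`, the uncapped flag `𝟙[GoodAt η]` is not `IsLocalFeature ρ`;
* `not_isLocal_avgRule_surplus` — for every `ρ ≥ 0`, `ρ₁`, tolerances `η₀, η₁ > 0`, weights `κ_T + C_T ≠ 0` and every pair potential `W`
  vanishing from some `R` on, lens-5's UNCAPPED ball-averaging rule `avgRule ρ (surplusF η₀ η₁ W e κ_T C_T)` is not `IsLocal ρ₁`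
  (at scale `s > max (ρ, ρ₁, R)` the centre's surplus jumps by `κ_T + C_T` between the star and its one-atom sub-cluster while `#B = 1` in both).

So critic row 518 (6)(a)'s «is `F_avg` a `TransferRule` with … `IsLocal`?» has the answer: range YES (`avgRule_hasRange`), locality NO as typed —
YES after capping the fit scale (`…AveragingRuleCap.avgRuleCap_restricted`), which only strengthens the certificate (`surplusCap ≤ surplus`).
DEF-FREE apart from the witness configuration `fccStar`.  [folklore]; 0 sorry.  Prover hand 2, gen 13 (decomp-a2c),
`--supports stmt-AtomisticToContinuum-27623`.
-/

noncomputable section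

namespace Summit.AtomisticToContinuum.Crystallization.Theorems.FrustratedLawDichotomyGoodFlagNonlocal

open scoped BigOperators Classical
open Literature.Geometry.DiscreteGeometry (fccKissingPattern card_fccKissingPattern norm_eq_one_of_mem_fccKissingPattern)
open Literature.MathematicalPhysics.StatisticalMechanics (siteEnergy)
open Summit.AtomisticToContinuum.Crystallization.Theorems.ChargedEnergyGapNegative (E3)
open Summit.AtomisticToContinuum.Crystallization.Theorems.FrustratedLawDichotomyRangeCut
open Summit.AtomisticToContinuum.Crystallization.Theorems.FrustratedLawDichotomyLocalDischargingRule
open Summit.AtomisticToContinuum.Crystallization.Theorems.FrustratedLawDichotomyRuleToolkit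
open Summit.AtomisticToContinuum.Crystallization.Theorems.FrustratedLawDichotomyAveragingCut (surplus ball ballAvg mem_ball)
open Summit.AtomisticToContinuum.Crystallization.Theorems.FrustratedLawDichotomyAveragingRule

/-! ## §1. The witness: the perfect fcc star at scale `s` -/

/-- An enumeration of the twelve fcc kissing vectors. -/
def fccEnum : ↥fccKissingPattern ≃ Fin 12 := fccKissingPattern.equivFin.trans (finCongr card_fccKissingPattern)

/-- **`fccStar s`** — the 13-atom cluster: the origin (index `0`) and the fcc kissing dozen scaled by `s` (indices `1 … 12`). -/
def fccStar (s : ℝ) : Fin (12 + 1) → E3 :=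
  Fin.cases (0 : E3) (fun k => s • ((fccEnum.symm k : ↥fccKissingPattern) : E3))

/-- The centre of the star. [folklore] -/
theorem fccStar_zero (s : ℝ) : fccStar s 0 = 0 := by
  simp [fccStar]

/-- The shell atoms of the star. [folklore] -/
theorem fccStar_succ (s : ℝ) (k : Fin 12) : fccStar s k.succ = s • ((fccEnum.symm k : ↥fccKissingPattern) : E3) := by
  simp [fccStar]

/-- Every shell atom sits at distance exactly `s` from the centre (`s ≥ 0`). [folklore] -/
theorem dist_fccStar_succ {s : ℝ} (hs : 0 ≤ s) (k : Fin 12) : dist (fccStar s k.succ) (fccStar s 0) = s := by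
  rw [fccStar_succ, fccStar_zero, dist_zero_right, norm_smul, Real.norm_eq_abs, abs_of_nonneg hs,
    norm_eq_one_of_mem_fccKissingPattern (fccEnum.symm k).2, mul_one]

/-- Every atom of the star other than the centre sits at distance exactly `s` from it. [folklore] -/
theorem dist_fccStar_of_ne {s : ℝ} (hs : 0 ≤ s) {k : Fin (12 + 1)} (hk : k ≠ 0) : dist (fccStar s k) (fccStar s 0) = s := by
  obtain ⟨j, rfl⟩ := Fin.exists_succ_eq.mpr hk
  exact dist_fccStar_succ hs j

/-- ★ **The centre of the perfect fcc star is `η`-good for every `η > 0`** (fit scale `d = s`, error `0`, clean gap `s/10`). [folklore] -/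
theorem goodAt_fccStar_centre {s η : ℝ} (hs : 0 < s) (hη : 0 < η) : GoodAt η (fccStar s) 0 := by
  refine ⟨s, 0, s / 10, LinearIsometry.id, Or.inl ⟨fun u => s • (u : E3), hs, by positivity, hη, fun u => ⟨?_, ?_⟩, ?_, ?_, ?_⟩⟩
  · refine ⟨(fccEnum u).succ, ?_⟩
    rw [fccStar_succ, Equiv.symm_apply_apply]
  · rw [fccStar_zero, sub_zero, LinearIsometry.id_apply, sub_self, norm_zero, zero_mul]
  · rintro x ⟨k, rfl⟩ hk
    have hk0 : k ≠ 0 := fun h => hk (by rw [h])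
    rw [dist_fccStar_of_ne hs.le hk0]
  · refine ⟨fccStar s (Fin.succ 0), ⟨Fin.succ 0, rfl⟩, fun h => ?_, (dist_fccStar_succ hs.le 0).le⟩
    have h1 := dist_fccStar_succ hs.le 0
    rw [h, dist_self] at h1
    exact hs.ne h1
  · rintro x ⟨k, rfl⟩ hk -
    have hk0 : k ≠ 0 := fun h => hk (by rw [h])
    obtain ⟨j, rfl⟩ := Fin.exists_succ_eq.mpr hk0
    refine ⟨by rw [dist_fccStar_succ hs.le j]; linarith, ⟨fccEnum.symm j, ?_⟩⟩
    rw [fccStar_succ]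

/-- **A cluster whose point set is a single point has no good site** (the pinning clause needs a second point). [folklore] -/
theorem not_goodAt_of_subsingleton_range {η : ℝ} {N : ℕ} {y : Fin N → E3} {i : Fin N} (h1 : ∀ k : Fin N, y k = y i) :
    ¬GoodAt η y i := by
  rintro ⟨d, η', γ, A, hor⟩
  rcases hor with ⟨t, -, -, -, -, -, ⟨x, ⟨k, rfl⟩, hne, -⟩, -⟩ | ⟨t, -, -, -, -, -, ⟨x, ⟨k, rfl⟩, hne, -⟩, -⟩
  · exact hne (h1 k)
  · exact hne (h1 k)

/-- The one-atom sub-cluster `{centre}` of the star: `φ₀ : Fin 1 → Fin 13`, `φ₀ _ = 0`. -/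
def φ₀ : Fin 1 → Fin (12 + 1) := fun _ => 0

/-- `φ₀` is injective. [folklore] -/
theorem φ₀_injective : Function.Injective φ₀ := fun a b _ => Subsingleton.elim a b

/-- For `s > ρ` the sub-cluster `{centre}` contains every atom of the star within `ρ` of the centre. [folklore] -/
theorem φ₀_sub {s ρ : ℝ} (hs : 0 ≤ s) (hρ : ρ < s) (a : Fin 1) :
    ∀ k : Fin (12 + 1), dist (fccStar s k) (fccStar s (φ₀ a)) ≤ ρ → k ∈ Set.range φ₀ := by
  intro k hk
  by_cases hk0 : k = 0
  · exact ⟨0, hk0.symm⟩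
  · rw [show φ₀ a = 0 from rfl, dist_fccStar_of_ne hs hk0] at hk
    exact absurd hk (not_le.mpr hρ)

/-- The centre of the one-atom sub-cluster is not good. [folklore] -/
theorem not_goodAt_centre_sub (s η : ℝ) : ¬GoodAt η (fccStar s ∘ φ₀) 0 :=
  not_goodAt_of_subsingleton_range fun k => by rw [Subsingleton.elim k 0]

/-! ## §2. Non-locality of the uncapped flag and of the uncapped averaging rule -/

/-- ★ **The UNCAPPED crystallinity flag `𝟙[GoodAt η]` is not a `ρ`-local feature**, for any radius `ρ` and any `η > 0`. [folklore] -/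
theorem not_isLocalFeature_goodAt (ρ : ℝ) {η : ℝ} (hη : 0 < η) :
    ¬IsLocalFeature ρ (fun _ y i => if GoodAt η y i then (1 : ℝ) else 0) := by
  intro hloc
  set s : ℝ := max ρ 0 + 1 with hsdef
  have hs : 0 < s := by have := le_max_right ρ 0; linarith
  have hρs : ρ < s := by have := le_max_left ρ 0; linarith
  have h := hloc (12 + 1) 1 (fccStar s) φ₀ φ₀_injective 0 (φ₀_sub hs.le hρs 0)
  beta_reduce at h
  rw [if_neg (not_goodAt_centre_sub s η), show φ₀ 0 = 0 from rfl, if_pos (goodAt_fccStar_centre hs hη)] at h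
  exact zero_ne_one h

/-- In the star at scale `s > ρ ≥ 0` (and in its one-atom sub-cluster) the `ρ`-ball of the centre is `{centre}`. [folklore] -/
theorem card_ball_centre {s ρ : ℝ} (hρ0 : 0 ≤ ρ) (hρ : ρ < s) : (ball ρ (fccStar s) 0).card = 1 ∧ (ball ρ (fccStar s ∘ φ₀) 0).card = 1 := by
  constructor
  · rw [Finset.card_eq_one]
    refine ⟨0, Finset.eq_singleton_iff_unique_mem.mpr ⟨by rw [mem_ball, dist_self]; exact hρ0, fun k hk => ?_⟩⟩
    by_contra hk0
    rw [mem_ball, dist_fccStar_of_ne (hρ0.trans hρ.le) hk0] at hk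
    exact absurd hk (not_le.mpr hρ)
  · rw [Finset.card_eq_one]
    exact ⟨0, Finset.eq_singleton_iff_unique_mem.mpr ⟨by rw [mem_ball, dist_self]; exact hρ0, fun k _ => Subsingleton.elim k 0⟩⟩

/-- The pair sums of the centre agree (both vanish up to `W 0`) once `W` vanishes from `R ≤ s` on. [folklore] -/
theorem siteEnergy_centre {W : ℝ → ℝ} {R s : ℝ} (hW : ∀ r, R ≤ r → W r = 0) (hs : 0 ≤ s) (hR : R ≤ s) :
    siteEnergy W (fccStar s) 0 = 0 ∧ siteEnergy W (fccStar s ∘ φ₀) 0 = 0 := by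
  constructor
  · unfold siteEnergy
    refine Finset.sum_eq_zero fun k hk => ?_
    have hk0 : k ≠ 0 := Finset.ne_of_mem_erase hk
    rw [dist_comm, dist_fccStar_of_ne hs hk0]
    exact hW s hR
  · unfold siteEnergy
    refine Finset.sum_eq_zero fun k hk => ?_
    exact absurd (Subsingleton.elim k 0) (Finset.ne_of_mem_erase hk)

/-- ★ **lens-5's UNCAPPED ball-averaging rule is not `IsLocal`**: for `ρ ≥ 0`, any `ρ₁`, tolerances `η₀, η₁ > 0`, `κ_T + C_T ≠ 0` and a pair
potential vanishing from some `R` on, `avgRule ρ (surplusF η₀ η₁ W e κ_T C_T)` is not `IsLocal ρ₁`. [folklore] -/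
theorem not_isLocal_avgRule_surplus {ρ ρ₁ η₀ η₁ : ℝ} {W : ℝ → ℝ} {e κT CT R : ℝ} (hρ0 : 0 ≤ ρ) (hη₀ : 0 < η₀) (hη₁ : 0 < η₁)
    (hκC : κT + CT ≠ 0) (hW : ∀ r, R ≤ r → W r = 0) : ¬IsLocal ρ₁ (avgRule ρ (surplusF η₀ η₁ W e κT CT)) := by
  intro hloc
  set s : ℝ := max (max ρ ρ₁) (max R 0) + 1 with hsdef
  have hm1 := le_max_left (max ρ ρ₁) (max R 0)
  have hm2 := le_max_right (max ρ ρ₁) (max R 0)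
  have hs : 0 < s := by have := le_max_right R 0; linarith
  have hρs : ρ < s := by have := le_max_left ρ ρ₁; linarith
  have hρ₁s : ρ₁ < s := by have := le_max_right ρ ρ₁; linarith
  have hRs : R ≤ s := by have := le_max_left R 0; linarith
  have hsub : ∀ k : Fin (12 + 1), dist (fccStar s k) (fccStar s (φ₀ 0)) ≤ ρ₁ ∨ dist (fccStar s k) (fccStar s (φ₀ 0)) ≤ ρ₁ →
      k ∈ Set.range φ₀ := fun k hk => φ₀_sub hs.le hρ₁s 0 k (hk.elim id id)
  have h := hloc (12 + 1) 1 (fccStar s) φ₀ φ₀_injective 0 0 hsub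
  obtain ⟨hc1, hc2⟩ := card_ball_centre hρ0 hρs
  obtain ⟨he1, he2⟩ := siteEnergy_centre (W := W) hW hs.le hRs
  have hmem1 : (0 : Fin 1) ∈ ball ρ (fccStar s ∘ φ₀) 0 := by rw [mem_ball, dist_self]; exact hρ0
  have hmem2 : (0 : Fin (12 + 1)) ∈ ball ρ (fccStar s) 0 := by rw [mem_ball, dist_self]; exact hρ0
  unfold avgRule at h
  rw [show φ₀ 0 = 0 from rfl, if_pos hmem1, if_pos hmem2, hc1, hc2] at h
  simp only [Nat.cast_one, div_one, surplusF, surplus, he1, he2, if_pos (goodAt_fccStar_centre hs hη₀),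
    if_pos (goodAt_fccStar_centre hs hη₁), if_neg (not_goodAt_centre_sub s η₀), if_neg (not_goodAt_centre_sub s η₁)] at h
  apply hκC
  linarith

end Summit.AtomisticToContinuum.Crystallization.Theorems.FrustratedLawDichotomyGoodFlagNonlocal

end
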